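import Mathlib
import Literature.MathematicalPhysics.StatisticalMechanics.LennardJonesClusters
import Literature.MathematicalPhysics.StatisticalMechanics.MuGroundStateConfiguration
import Summits.AtomisticToContinuum.Crystallization.Theorems.PricedLinkCensusTruncatedCensusGapSuperstableRedistribution

/-!
# Separated reduction of the sharp m-potential — auxiliary transport and restriction lemmas

Auxiliary file for the stub `stub_separatedReduction` of the line `sharp-m-potential-compactness`
(crux `PricedLinkCensus.TruncatedCensusGap`, item stmt-AtomisticToContinuum-14230).  Pure finite
bookkeeping about finite configurations `y : Fin N → ℝ³`:

* site energies of a finite-range potential transport along an isometric correspondence of the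
  point clouds of two rooted patches (`siteEnergy_eq_of_isometry`), and so does
  `1/4`-crowd-freeness (`crowdFree_of_isometry`);
* the `1/4`-crowd-free sites are enumerated by an embedding `f : Fin M ↪ Fin N`
  (`exists_crowdFree_enum`); the sub-configuration `y ∘ f` is `1/4`-separated and its patches
  correspond to those of `y` (`sub_range_transport`);
* on a `1/4`-TAME closed `R`-patch the restriction `z : Fin L → ℝ³` of `y` to the patch is an
  injective separated configuration indexed through an `Equiv` with the patch
  (`exists_restrict`), bijective matchings and near-Barlow data pass between `y` and `z`
  (`restrict_equiv`, `sep_of_restrict`, `ballMatch_of_restrict`), and a site functional that is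
  patch-local at radius `R - 1/4` between separated configurations takes the same value at the
  root of `z` as at the corresponding site of the crowd-free sub-configuration
  (`exists_tame_restrict`, the "z-trick").
-/

noncomputable section

namespace Summit.AtomisticToContinuum.Crystallization.Theorems.PricedLinkCensusTruncatedCensusGap

open scoped BigOperators Classical
open Literature.MathematicalPhysics.StatisticalMechanics

/-! ## Transport along isometric correspondences of patches -/

-- adapted from `cloud_eq_image` in `PricedLinkCensusTruncatedCensusGapSuperstableRedistribution`
/-- Under the hypotheses of patch-locality at radius `ρ`, the point cloud of `y'` in the closed
`ρ`-ball about `y' i'` is the image under `g` of that of `y` about `y i`. [folklore] -/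
theorem cloud_eq_image_radius (ρ : ℝ) {N N' : ℕ} (y : Fin N → EuclideanSpace ℝ (Fin 3))
    (y' : Fin N' → EuclideanSpace ℝ (Fin 3)) (i : Fin N) (i' : Fin N')
    (g : EuclideanSpace ℝ (Fin 3) ≃ᵃⁱ[ℝ] EuclideanSpace ℝ (Fin 3)) (hg : g (y i) = y' i')
    (h1 : ∀ j : Fin N, dist (y j) (y i) ≤ ρ → g (y j) ∈ Set.range y')
    (h2 : ∀ j' : Fin N', dist (y' j') (y' i') ≤ ρ → y' j' ∈ g '' Set.range y) :
    (Finset.univ.filter fun k' => dist (y' k') (y' i') ≤ ρ).image y' =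
      ((Finset.univ.filter fun k => dist (y k) (y i) ≤ ρ).image y).image g := by
  ext p
  simp only [Finset.mem_image, Finset.mem_filter, Finset.mem_univ, true_and]
  constructor
  · rintro ⟨k', hk', rfl⟩
    obtain ⟨x, ⟨k, rfl⟩, hk⟩ := h2 k' hk'
    refine ⟨y k, ⟨k, ?_, rfl⟩, hk⟩
    rw [← g.dist_map, hk, hg]
    exact hk'
  · rintro ⟨x, ⟨k, hk, rfl⟩, rfl⟩
    obtain ⟨k', hk'⟩ := h1 k hk
    refine ⟨k', ?_, hk'⟩
    rw [hk', ← hg, g.dist_map]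
    exact hk

/-- For an injective configuration and a potential vanishing beyond `ρ`, the site energy of `i`
is a sum over the point cloud of the closed `ρ`-ball about `y i` (root removed). [folklore] -/
theorem siteEnergy_eq_cloud_sum (V : ℝ → ℝ) (ρ : ℝ) (hV : ∀ r, ρ < r → V r = 0) {N : ℕ}
    (y : Fin N → EuclideanSpace ℝ (Fin 3)) (hy : Function.Injective y) (i : Fin N) :
    siteEnergy V y i =
      ∑ p ∈ ((Finset.univ.filter fun k => dist (y k) (y i) ≤ ρ).image y).erase (y i),
        V (dist (y i) p) := by
  rw [← Finset.image_erase hy, Finset.sum_image hy.injOn, ← Finset.filter_erase,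
    Finset.sum_filter, siteEnergy]
  refine Finset.sum_congr rfl fun k _ => ?_
  split_ifs with h
  · rfl
  · exact hV _ (by rw [dist_comm]; exact not_le.mp h)

/-- **Transport of site energies.** For a potential vanishing beyond `ρ`, the site energies of
two injective configurations at roots whose closed `ρ`-patches correspond under an isometry `g`
of `ℝ³` agree. [folklore] -/
theorem siteEnergy_eq_of_isometry (V : ℝ → ℝ) (ρ : ℝ) (hV : ∀ r, ρ < r → V r = 0) {N N' : ℕ}
    (y : Fin N → EuclideanSpace ℝ (Fin 3)) (y' : Fin N' → EuclideanSpace ℝ (Fin 3))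
    (i : Fin N) (i' : Fin N') (g : EuclideanSpace ℝ (Fin 3) ≃ᵃⁱ[ℝ] EuclideanSpace ℝ (Fin 3))
    (hy : Function.Injective y) (hy' : Function.Injective y') (hg : g (y i) = y' i')
    (h1 : ∀ j : Fin N, dist (y j) (y i) ≤ ρ → g (y j) ∈ Set.range y')
    (h2 : ∀ j' : Fin N', dist (y' j') (y' i') ≤ ρ → y' j' ∈ g '' Set.range y) :
    siteEnergy V y i = siteEnergy V y' i' := by
  rw [siteEnergy_eq_cloud_sum V ρ hV y hy i, siteEnergy_eq_cloud_sum V ρ hV y' hy' i',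
    cloud_eq_image_radius ρ y y' i i' g hg h1 h2, ← hg, ← Finset.image_erase g.injective,
    Finset.sum_image g.injective.injOn]
  exact Finset.sum_congr rfl fun p _ => by rw [g.dist_map]

/-- **Transport of crowd-freeness.** If `g` carries `y i` to `y' i'` and every site of `y'`
within `1/4` of `y' i'` is the `g`-image of a site of `y`, then `1/4`-crowd-freeness of `i` in `y`
implies that of `i'` in the injective configuration `y'`. [folklore] -/
theorem crowdFree_of_isometry {N N' : ℕ} (y : Fin N → EuclideanSpace ℝ (Fin 3))
    (y' : Fin N' → EuclideanSpace ℝ (Fin 3)) (i : Fin N) (i' : Fin N')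
    (g : EuclideanSpace ℝ (Fin 3) ≃ᵃⁱ[ℝ] EuclideanSpace ℝ (Fin 3)) (hy' : Function.Injective y')
    (hg : g (y i) = y' i')
    (h2 : ∀ k' : Fin N', dist (y' k') (y' i') < 1 / 4 → y' k' ∈ g '' Set.range y)
    (hcf : ∀ k : Fin N, k ≠ i → 1 / 4 ≤ dist (y k) (y i)) :
    ∀ k' : Fin N', k' ≠ i' → 1 / 4 ≤ dist (y' k') (y' i') := by
  intro k' hk'
  by_contra hlt
  obtain ⟨x, ⟨k, rfl⟩, hk⟩ := h2 k' (not_le.mp hlt)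
  by_cases hki : k = i
  · subst hki
    exact hk' (hy' (hk.symm.trans hg))
  · have h := hcf k hki
    rw [← g.dist_map, hk, hg] at h
    exact hlt h

/-- `crowdFree_of_isometry` in the reverse direction (from `y'` back to `y`, the correspondence
being given, as in patch-locality, by `g (y k) ∈ Set.range y'`). [folklore] -/
theorem crowdFree_of_isometry' {N N' : ℕ} (y : Fin N → EuclideanSpace ℝ (Fin 3))
    (y' : Fin N' → EuclideanSpace ℝ (Fin 3)) (i : Fin N) (i' : Fin N')
    (g : EuclideanSpace ℝ (Fin 3) ≃ᵃⁱ[ℝ] EuclideanSpace ℝ (Fin 3)) (hy : Function.Injective y)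
    (hg : g (y i) = y' i')
    (h1 : ∀ k : Fin N, dist (y k) (y i) < 1 / 4 → g (y k) ∈ Set.range y')
    (hcf' : ∀ k' : Fin N', k' ≠ i' → 1 / 4 ≤ dist (y' k') (y' i')) :
    ∀ k : Fin N, k ≠ i → 1 / 4 ≤ dist (y k) (y i) := by
  refine crowdFree_of_isometry y' y i' i g.symm hy (by rw [← hg, g.symm_apply_apply])
    (fun k hk => ?_) hcf'
  obtain ⟨k', hk'⟩ := h1 k hk
  exact ⟨y' k', ⟨k', rfl⟩, by rw [hk', g.symm_apply_apply]⟩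

/-! ## The crowd-free sub-configuration -/

/-- The `1/4`-crowd-free sites of a finite configuration are the range of an embedding
`Fin M ↪ Fin N`. [folklore] -/
theorem exists_crowdFree_enum {N : ℕ} (y : Fin N → EuclideanSpace ℝ (Fin 3)) :
    ∃ (M : ℕ) (f : Fin M ↪ Fin N),
      ∀ k : Fin N, k ∈ Set.range f ↔ ∀ k' : Fin N, k' ≠ k → 1 / 4 ≤ dist (y k') (y k) := by
  set s := Finset.univ.filter fun k : Fin N => ∀ k' : Fin N, k' ≠ k → 1 / 4 ≤ dist (y k') (y k)
    with hs
  refine ⟨s.card, (s.orderEmbOfFin rfl).toEmbedding, fun k => ?_⟩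
  rw [show Set.range ⇑(s.orderEmbOfFin rfl).toEmbedding = Set.range (s.orderEmbOfFin rfl) from rfl,
    Finset.range_orderEmbOfFin, Finset.mem_coe, hs, Finset.mem_filter]
  simp

/-- The sub-configuration of the crowd-free sites is `1/4`-separated. [folklore] -/
theorem sub_separated {N M : ℕ} (y : Fin N → EuclideanSpace ℝ (Fin 3)) (f : Fin M ↪ Fin N)
    (hf : ∀ k : Fin N, k ∈ Set.range f ↔ ∀ k' : Fin N, k' ≠ k → 1 / 4 ≤ dist (y k') (y k)) :
    ∀ j k : Fin M, j ≠ k → 1 / 4 ≤ dist ((y ∘ f) j) ((y ∘ f) k) :=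
  fun j k hjk => (hf (f k)).1 ⟨k, rfl⟩ (f j) fun h => hjk (f.injective h)

/-- A fibre sum over an embedding collapses to the single term. [folklore] -/
theorem sum_filter_embedding_eq {M N : ℕ} (f : Fin M ↪ Fin N) (G : Fin M → ℝ) (i : Fin M) :
    ∑ i' ∈ Finset.univ.filter (fun i' => f i' = f i), G i' = G i := by
  rw [Finset.sum_filter]
  simp

/-- A fibre sum over an embedding vanishes off the range. [folklore] -/
theorem sum_filter_embedding_eq_zero {M N : ℕ} (f : Fin M ↪ Fin N) (G : Fin M → ℝ) (i : Fin N)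
    (hi : i ∉ Set.range f) : ∑ i' ∈ Finset.univ.filter (fun i' => f i' = i), G i' = 0 :=
  Finset.sum_eq_zero fun i' hi' => absurd ⟨i', (Finset.mem_filter.1 hi').2⟩ hi

/-- **Correspondence of crowd-free sub-configurations.** If the closed `R`-patches of `y` about
`y (f i)` and of `y'` about `y' (f' i')` correspond under `g` (`f`, `f'` enumerating the crowd-free
sites), then so do the closed `ρ`-patches of the crowd-free sub-configurations, `ρ + 1/4 ≤ R`
(crowd-freeness of a site is decided within `1/4` of it). [folklore] -/
theorem sub_range_transport {N N' M M' : ℕ} (y : Fin N → EuclideanSpace ℝ (Fin 3))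
    (y' : Fin N' → EuclideanSpace ℝ (Fin 3)) (f : Fin M ↪ Fin N) (f' : Fin M' ↪ Fin N')
    (hf : ∀ k : Fin N, k ∈ Set.range f ↔ ∀ k' : Fin N, k' ≠ k → 1 / 4 ≤ dist (y k') (y k))
    (hf' : ∀ k : Fin N', k ∈ Set.range f' ↔ ∀ k' : Fin N', k' ≠ k → 1 / 4 ≤ dist (y' k') (y' k))
    (i : Fin M) (i' : Fin M') (g : EuclideanSpace ℝ (Fin 3) ≃ᵃⁱ[ℝ] EuclideanSpace ℝ (Fin 3))
    (hy : Function.Injective y) (hy' : Function.Injective y') (hg : g (y (f i)) = y' (f' i'))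
    {ρ R : ℝ} (hρ : ρ + 1 / 4 ≤ R)
    (h1 : ∀ j : Fin N, dist (y j) (y (f i)) ≤ R → g (y j) ∈ Set.range y')
    (h2 : ∀ j' : Fin N', dist (y' j') (y' (f' i')) ≤ R → y' j' ∈ g '' Set.range y) :
    (∀ j : Fin M, dist ((y ∘ f) j) ((y ∘ f) i) ≤ ρ → g ((y ∘ f) j) ∈ Set.range (y' ∘ f')) ∧
    (∀ j' : Fin M', dist ((y' ∘ f') j') ((y' ∘ f') i') ≤ ρ →
      (y' ∘ f') j' ∈ g '' Set.range (y ∘ f)) := by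
  constructor
  · intro j hj
    simp only [Function.comp_apply] at hj ⊢
    obtain ⟨j', hj'⟩ := h1 (f j) (by linarith)
    have hcf' : ∀ k' : Fin N', k' ≠ j' → 1 / 4 ≤ dist (y' k') (y' j') := by
      refine crowdFree_of_isometry y y' (f j) j' g hy' hj'.symm (fun k' hk' => h2 k' ?_)
        ((hf (f j)).1 ⟨j, rfl⟩)
      have : dist (y' j') (y' (f' i')) ≤ ρ := by rw [hj', ← hg, g.dist_map]; exact hj
      linarith [dist_triangle (y' k') (y' j') (y' (f' i'))]
    obtain ⟨j'', hj''⟩ := (hf' j').2 hcf'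
    exact ⟨j'', by simp only [Function.comp_apply]; rw [hj'', hj']⟩
  · intro j' hj'
    simp only [Function.comp_apply] at hj' ⊢
    obtain ⟨x, ⟨j, rfl⟩, hj⟩ := h2 (f' j') (by linarith)
    have hcf : ∀ k : Fin N, k ≠ j → 1 / 4 ≤ dist (y k) (y j) := by
      refine crowdFree_of_isometry' y y' j (f' j') g hy hj (fun k hk => h1 k ?_)
        ((hf' (f' j')).1 ⟨j', rfl⟩)
      have hdj : dist (y j) (y (f i)) ≤ ρ := by rw [← g.dist_map, hj, hg]; exact hj'
      linarith [dist_triangle (y k) (y j) (y (f i))]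
    obtain ⟨j'', hj''⟩ := (hf j).2 hcf
    exact ⟨y j, ⟨j'', by simp only [Function.comp_apply]; rw [hj'']⟩, hj⟩

/-! ## Tame patches and the restriction to a patch -/

/-- On a `1/4`-tame closed `R`-patch, every site within `R - 1/4` of the root is `1/4`-crowd-free.
[folklore] -/
theorem crowdFree_of_tame {N : ℕ} (y : Fin N → EuclideanSpace ℝ (Fin 3)) (i j : Fin N) {R : ℝ}
    (ht : ∀ j k : Fin N, j ≠ k → dist (y j) (y i) ≤ R → dist (y k) (y i) ≤ R →
      1 / 4 ≤ dist (y j) (y k))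
    (hj : dist (y j) (y i) ≤ R - 1 / 4) : ∀ k : Fin N, k ≠ j → 1 / 4 ≤ dist (y k) (y j) := by
  intro k hk
  by_contra hlt
  have h := ht k j hk (by linarith [dist_triangle (y k) (y j) (y i), not_le.mp hlt]) (by linarith)
  exact hlt h

/-- On a `1/4`-tame closed `R`-patch (`9/4 ≤ R`) the site energy of the root for a potential
vanishing beyond `2` equals its site energy in the crowd-free sub-configuration. [folklore] -/
theorem siteEnergy_sub_eq_of_tame (V : ℝ → ℝ) (hV : ∀ r, 2 < r → V r = 0) {N M : ℕ}
    (y : Fin N → EuclideanSpace ℝ (Fin 3)) (hy : Function.Injective y) (f : Fin M ↪ Fin N)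
    (hf : ∀ k : Fin N, k ∈ Set.range f ↔ ∀ k' : Fin N, k' ≠ k → 1 / 4 ≤ dist (y k') (y k))
    (i : Fin M) {R : ℝ} (hR : 9 / 4 ≤ R)
    (ht : ∀ j k : Fin N, j ≠ k → dist (y j) (y (f i)) ≤ R → dist (y k) (y (f i)) ≤ R →
      1 / 4 ≤ dist (y j) (y k)) :
    siteEnergy V y (f i) = siteEnergy V (y ∘ f) i := by
  refine siteEnergy_eq_of_isometry V 2 hV y (y ∘ f) (f i) i (AffineIsometryEquiv.refl ℝ _) hy
    (hy.comp f.injective) rfl (fun j hj => ?_) (fun j' _ => ⟨y (f j'), ⟨f j', rfl⟩, rfl⟩)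
  obtain ⟨j', hj'⟩ := (hf j).2 (crowdFree_of_tame y (f i) j ht (by linarith))
  exact ⟨j', by simp [hj']⟩

/-- **Restriction to a tame patch.** The sites of the closed `R`-patch of an injective
configuration `y` about `y i`, `1/4`-tame, form an injective `1/4`-separated configuration
`z : Fin L → ℝ³` indexed through an `Equiv` with the patch, rooted at `z r = y i`, all of whose
sites lie within `R` of the root. [folklore] -/
theorem exists_restrict {N : ℕ} (y : Fin N → EuclideanSpace ℝ (Fin 3)) (hy : Function.Injective y)
    (i : Fin N) {R : ℝ} (hR : 0 ≤ R)
    (ht : ∀ j k : Fin N, j ≠ k → dist (y j) (y i) ≤ R → dist (y k) (y i) ≤ R →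
      1 / 4 ≤ dist (y j) (y k)) :
    ∃ (L : ℕ) (z : Fin L → EuclideanSpace ℝ (Fin 3)) (r : Fin L)
      (ez : Fin L ≃ {j : Fin N // dist (y j) (y i) ≤ R}),
      (∀ l, z l = y (ez l).1) ∧ z r = y i ∧ Function.Injective z ∧
      (∀ j k : Fin L, j ≠ k → 1 / 4 ≤ dist (z j) (z k)) ∧ (∀ l, dist (z l) (z r) ≤ R) := by
  set ez := (Fintype.equivFin {j : Fin N // dist (y j) (y i) ≤ R}).symm
  have hr : (ez (ez.symm ⟨i, by rw [dist_self]; exact hR⟩)).1 = i := by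
    rw [Equiv.apply_symm_apply]
  refine ⟨_, fun l => y (ez l).1, ez.symm ⟨i, by rw [dist_self]; exact hR⟩, ez, fun l => rfl,
    by simp only [hr], fun l l' h => ez.injective (Subtype.ext (hy h)),
    fun j k hjk => ht _ _ (fun h => hjk (ez.injective (Subtype.ext h))) (ez j).2 (ez k).2,
    fun l => by simp only [hr]; exact (ez l).2⟩

/-- **Bijective matchings pass to the restrictions.** A bijective `θ`-matching (after `g`) of the
closed `R`-patches of `y` and `y'` is a bijective `θ`-matching of the closed `R`-patches of their
restrictions `z`, `z'` (which are all of `z`, `z'`). [folklore] -/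
theorem restrict_equiv {N N' L L' : ℕ} (y : Fin N → EuclideanSpace ℝ (Fin 3))
    (y' : Fin N' → EuclideanSpace ℝ (Fin 3)) (i : Fin N) (i' : Fin N') {R θ : ℝ}
    (z : Fin L → EuclideanSpace ℝ (Fin 3)) (z' : Fin L' → EuclideanSpace ℝ (Fin 3))
    (r : Fin L) (r' : Fin L')
    (ez : Fin L ≃ {j : Fin N // dist (y j) (y i) ≤ R})
    (ez' : Fin L' ≃ {j' : Fin N' // dist (y' j') (y' i') ≤ R})
    (hz : ∀ l, z l = y (ez l).1) (hz' : ∀ l', z' l' = y' (ez' l').1)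
    (hzR : ∀ l, dist (z l) (z r) ≤ R) (hz'R : ∀ l', dist (z' l') (z' r') ≤ R)
    (g : EuclideanSpace ℝ (Fin 3) ≃ᵃⁱ[ℝ] EuclideanSpace ℝ (Fin 3))
    (e : {j : Fin N // dist (y j) (y i) ≤ R} ≃ {j' : Fin N' // dist (y' j') (y' i') ≤ R})
    (he : ∀ j, dist (g (y j.1)) (y' (e j).1) ≤ θ) :
    ∃ e'' : {l : Fin L // dist (z l) (z r) ≤ R} ≃ {l' : Fin L' // dist (z' l') (z' r') ≤ R},
      ∀ l, dist (g (z l.1)) (z' (e'' l).1) ≤ θ := by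
  refine ⟨(Equiv.subtypeUnivEquiv hzR).trans <| (ez.trans <| e.trans ez'.symm).trans
    (Equiv.subtypeUnivEquiv hz'R).symm, fun l => ?_⟩
  simp only [Equiv.trans_apply, Equiv.subtypeUnivEquiv_apply, Equiv.subtypeUnivEquiv_symm_apply]
  rw [hz, hz', Equiv.apply_symm_apply]
  exact he _

/-- **Separation within `4a` passes from the restriction back to `y`** when `9a/2 ≤ R`: two sites
of `y`, one within `4a` of the root, are either both in the closed `R`-patch or more than
`R - 4a ≥ a/2` apart. [folklore] -/
theorem sep_of_restrict {N L : ℕ} (y : Fin N → EuclideanSpace ℝ (Fin 3)) (i : Fin N) {R a : ℝ}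
    (ha : 0 < a) (haR : 9 / 2 * a ≤ R) (z : Fin L → EuclideanSpace ℝ (Fin 3)) (r : Fin L)
    (ez : Fin L ≃ {j : Fin N // dist (y j) (y i) ≤ R}) (hz : ∀ l, z l = y (ez l).1)
    (hzr : z r = y i)
    (hsep : ∀ j k : Fin L, j ≠ k → dist (z j) (z r) ≤ 4 * a → a / 2 ≤ dist (z j) (z k)) :
    ∀ j k : Fin N, j ≠ k → dist (y j) (y i) ≤ 4 * a → a / 2 ≤ dist (y j) (y k) := by
  intro j k hjk hj
  by_cases hk : dist (y k) (y i) ≤ R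
  · have hjR : dist (y j) (y i) ≤ R := by linarith
    have h := hsep (ez.symm ⟨j, hjR⟩) (ez.symm ⟨k, hk⟩)
      (fun h => hjk (by simpa using congrArg (fun l => (ez l).1) h))
      (by rw [hz, hzr, Equiv.apply_symm_apply]; exact hj)
    rwa [hz, hz, Equiv.apply_symm_apply, Equiv.apply_symm_apply] at h
  · linarith [dist_triangle (y k) (y j) (y i), dist_comm (y j) (y k), not_le.mp hk]

/-- **Two-way matchings pass from the restriction back to `y`** at any radius `ρ' ≤ R`: the range
of the restriction lies in the range of `y` and contains its part in the closed `R`-patch.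
[folklore] -/
theorem ballMatch_of_restrict {N L : ℕ} (y : Fin N → EuclideanSpace ℝ (Fin 3)) (i : Fin N)
    {R δ' ρ' : ℝ} (hρR : ρ' ≤ R) (z : Fin L → EuclideanSpace ℝ (Fin 3)) (r : Fin L)
    (ez : Fin L ≃ {j : Fin N // dist (y j) (y i) ≤ R}) (hz : ∀ l, z l = y (ez l).1)
    (hzr : z r = y i) (S : Set (EuclideanSpace ℝ (Fin 3)))
    (h : BallMatch δ' ρ' (z r) (Set.range z) S) : BallMatch δ' ρ' (y i) (Set.range y) S := by
  rw [hzr] at h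
  refine ⟨fun s hs hsd => ?_, fun a ha had => ?_⟩
  · obtain ⟨p, ⟨l, rfl⟩, hp⟩ := h.1 s hs hsd
    exact ⟨z l, ⟨(ez l).1, (hz l).symm⟩, hp⟩
  · obtain ⟨j, rfl⟩ := ha
    exact h.2 (y j) ⟨ez.symm ⟨j, had.trans hρR⟩, by rw [hz, Equiv.apply_symm_apply]⟩ had

/-- **The energy per particle bound is non-positive**: applied to the one-point configuration
(energy `0`), domination and non-negativity of a site functional give `e₀ ≤ 0`. [folklore] -/
theorem e0_nonpos (e₀ : ℝ) (Hs : (N : ℕ) → (Fin N → EuclideanSpace ℝ (Fin 3)) → Fin N → ℝ)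
    (V : ℝ → ℝ)
    (dom : ∀ (N : ℕ) (y : Fin N → EuclideanSpace ℝ (Fin 3)), Function.Injective y →
      (∀ j k : Fin N, j ≠ k → 1 / 4 ≤ dist (y j) (y k)) →
      ∑ i, Hs N y i ≤ interactionEnergy V y - (N : ℝ) * e₀)
    (nonneg : ∀ (N : ℕ) (y : Fin N → EuclideanSpace ℝ (Fin 3)) (i : Fin N),
      Function.Injective y → (∀ j k : Fin N, j ≠ k → 1 / 4 ≤ dist (y j) (y k)) → 0 ≤ Hs N y i) :
    e₀ ≤ 0 := by
  have hinj : Function.Injective (fun _ : Fin 1 => (0 : EuclideanSpace ℝ (Fin 3))) :=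
    fun a b _ => Subsingleton.elim a b
  have hsep : ∀ j k : Fin 1, j ≠ k →
      1 / 4 ≤ dist ((fun _ : Fin 1 => (0 : EuclideanSpace ℝ (Fin 3))) j) ((fun _ => 0) k) :=
    fun j k hjk => absurd (Subsingleton.elim j k) hjk
  have h1 := dom 1 _ hinj hsep
  have h2 := nonneg 1 _ 0 hinj hsep
  have hE : interactionEnergy V (fun _ : Fin 1 => (0 : EuclideanSpace ℝ (Fin 3))) = 0 := by
    have h := two_mul_interactionEnergy V (fun _ : Fin 1 => (0 : EuclideanSpace ℝ (Fin 3)))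
    rw [Fin.sum_univ_one, siteEnergy, Finset.sum_eq_zero (fun k hk => ?_)] at h
    · linarith
    · exact absurd (Subsingleton.elim k 0) (Finset.ne_of_mem_erase hk)
  rw [Fin.sum_univ_one, hE] at h1
  push_cast at h1
  linarith

/-- **The z-trick.** Let `Hs` be patch-local at radius `R - 1/4` between `1/4`-separated injective
configurations (`9/4 ≤ R`), let `f` enumerate the crowd-free sites of the injective configuration
`y`, and let the closed `R`-patch of `y` about the crowd-free site `y (f i)` be `1/4`-tame.  Then
the restriction `z` of `y` to that patch (injective, separated, rooted at `z r = y (f i)`, indexed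
through an `Equiv` with the patch) satisfies `Hs M (y ∘ f) i = Hs L z r`. [folklore] -/
theorem exists_tame_restrict :
    ∀ (Hs : (N : ℕ) → (Fin N → EuclideanSpace ℝ (Fin 3)) → Fin N → ℝ) (R : ℝ), 9 / 4 ≤ R →
      (∀ (N N' : ℕ) (y : Fin N → EuclideanSpace ℝ (Fin 3)) (y' : Fin N' → EuclideanSpace ℝ (Fin 3))
          (i : Fin N) (i' : Fin N')
          (g : EuclideanSpace ℝ (Fin 3) ≃ᵃⁱ[ℝ] EuclideanSpace ℝ (Fin 3)),
        Function.Injective y → Function.Injective y' →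
        (∀ j k : Fin N, j ≠ k → 1 / 4 ≤ dist (y j) (y k)) →
        (∀ j k : Fin N', j ≠ k → 1 / 4 ≤ dist (y' j) (y' k)) →
        g (y i) = y' i' →
        (∀ j : Fin N, dist (y j) (y i) ≤ R - 1 / 4 → g (y j) ∈ Set.range y') →
        (∀ j' : Fin N', dist (y' j') (y' i') ≤ R - 1 / 4 → y' j' ∈ g '' Set.range y) →
        Hs N y i = Hs N' y' i') →
      ∀ (N M : ℕ) (y : Fin N → EuclideanSpace ℝ (Fin 3)), Function.Injective y →
        ∀ (f : Fin M ↪ Fin N),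
        (∀ k : Fin N, k ∈ Set.range f ↔ ∀ k' : Fin N, k' ≠ k → 1 / 4 ≤ dist (y k') (y k)) →
        ∀ i : Fin M,
        (∀ j k : Fin N, j ≠ k → dist (y j) (y (f i)) ≤ R → dist (y k) (y (f i)) ≤ R →
          1 / 4 ≤ dist (y j) (y k)) →
        ∃ (L : ℕ) (z : Fin L → EuclideanSpace ℝ (Fin 3)) (r : Fin L)
          (ez : Fin L ≃ {j : Fin N // dist (y j) (y (f i)) ≤ R}),
          (∀ l, z l = y (ez l).1) ∧ z r = y (f i) ∧ Function.Injective z ∧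
          (∀ j k : Fin L, j ≠ k → 1 / 4 ≤ dist (z j) (z k)) ∧ (∀ l, dist (z l) (z r) ≤ R) ∧
          Hs M (y ∘ f) i = Hs L z r := by
  intro Hs R hR locS N M y hy f hf i ht
  obtain ⟨L, z, r, ez, hz, hzr, hzinj, hzsep, hzR⟩ := exists_restrict y hy (f i) (by linarith) ht
  refine ⟨L, z, r, ez, hz, hzr, hzinj, hzsep, hzR, ?_⟩
  refine locS M L (y ∘ f) z i r (AffineIsometryEquiv.refl ℝ _) (hy.comp f.injective) hzinj
    (sub_separated y f hf) hzsep (by simp [hzr]) (fun j hj => ?_) (fun l hl => ?_)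
  · have hjR : dist (y (f j)) (y (f i)) ≤ R := by
      simp only [Function.comp_apply] at hj
      linarith
    exact ⟨ez.symm ⟨f j, hjR⟩, by simp [hz]⟩
  · rw [hz l, hzr] at hl
    obtain ⟨j', hj'⟩ := (hf _).2 (crowdFree_of_tame y (f i) (ez l).1 ht hl)
    exact ⟨y (f j'), ⟨j', rfl⟩, by simp [hz, hj']⟩

end Summit.AtomisticToContinuum.Crystallization.Theorems.PricedLinkCensusTruncatedCensusGap

end
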